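import Mathlib
import HarnessLib

set_option linter.dupNamespace false

/-!
# Completion-like pairs: finite-length transfer, passage to a quotient pair, tensor translation

`[OURS · L w44b · completion model, ascent half · res-type-015 gen 15]` — fourth brick towards the
discharge of the named fact `Literature.RingTheory.CohomologyAnnihilator.le_caCompletion_comap`
([BahlekehHakimianSalarianTakahashi2015, Thm. 4.5 (2)]), helper for the surface rung
`PersistenceSurface` (stmt-ResolutionOfSingularities-19970) of crux chain w44b.  NOT a statement of
the manuscript under adjudication in cell res-hironaka; pure commutative algebra over Mathlib.

A **completion-like pair** is an algebra `R → S` of local rings with `𝔪S = 𝔫` and `R` dense in `S`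
(`∀ k s, ∃ r, s - r ∈ 𝔫ᵏ`); with `S` flat over `R` this is what the induction of the sibling file
`…CompletionAscentRetract` uses of `R → R̂` (no name is introduced; the two hypotheses are spelled
out).  This file proves:

* `mk_one_bijective_of_pow_smul_eq_zero` — **finite-length transfer**: for such a pair with `S`
  faithfully flat and an `R`-module `A` killed by `𝔪ᵏ`, `a ↦ 1 ⊗ a : A → S ⊗_R A` is bijective;
  `finite_restrictScalars_of_pow_smul_eq_zero` — an `S`-finite module killed by `𝔫ᵏ` is `R`-finite;
* passage to the quotient pair `(R/I, S/IS)`: `map_mk_maximalIdeal`, `map_maximalIdeal_quotient`,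
  `dense_quotient` (the two hypotheses are inherited; flatness is Mathlib's
  `Algebra.TensorProduct.quotIdealMapEquivQuotTensor`);
* `exists_retract_of_retract_quotientPair` — **tensor translation**: for an `R/I`-module `N`, a
  retract (over `S/IS`) of `(S/IS) ⊗_{R/I} N` is, after restriction of scalars to `S`, a retract of
  `S ⊗_R N` (the two tensor products agree; we only construct the two comparison maps as additive
  homomorphisms with the evident semilinearity, which is all a retract needs).

References: A. Bahlekeh, E. Hakimian, S. Salarian, R. Takahashi, arXiv:1504.06163, §4
[`BahlekehHakimianSalarianTakahashi2015`]; H. Matsumura, *Commutative Ring Theory*, §8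
[`Matsumura1987`].
-/

noncomputable section

open IsLocalRing
open scoped TensorProduct

universe u

namespace Summit.ResolutionOfSingularities.ResolutionOfSingularities.Theorems.HomologicalConductor.CompletionAscentQuotientPair

variable {R S : Type u} [CommRing R] [CommRing S] [Algebra R S]

/-! ## Finite-length transfer -/

/-- For `n` in the extension of an ideal `I` of `R` and `a` killed by `I`, `n ⊗ a = 0` in
`S ⊗_R A`. [folklore] -/
theorem tmul_eq_zero_of_mem_map {I : Ideal R} {A : Type u} [AddCommGroup A] [Module R A]
    (hA : ∀ x ∈ I, ∀ a : A, x • a = 0) {n : S} (hn : n ∈ I.map (algebraMap R S)) (a : A) :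
    n ⊗ₜ[R] a = 0 := by
  induction hn using Submodule.span_induction with
  | mem x hx =>
    obtain ⟨y, hy, rfl⟩ := hx
    rw [Algebra.algebraMap_eq_smul_one, TensorProduct.smul_tmul, hA y hy a, TensorProduct.tmul_zero]
  | zero => exact TensorProduct.zero_tmul _ _
  | add x y _ _ hx hy => rw [TensorProduct.add_tmul, hx, hy, add_zero]
  | smul s x _ hx => rw [← TensorProduct.smul_tmul', hx, smul_zero]

/-- **Finite-length transfer.**  Let `R → S` be faithfully flat with `𝔪S = 𝔫` and `R` dense in `S`
(`s ≡ r mod 𝔫ᵏ`).  If the `R`-module `A` is killed by `𝔪ᵏ`, then `a ↦ 1 ⊗ a : A → S ⊗_R A` is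
bijective (`A ≅ Â` for modules of finite length).  Injectivity is faithful flatness; for
surjectivity, `s ⊗ a = (r + n) ⊗ a = 1 ⊗ r a` with `n ∈ 𝔫ᵏ = 𝔪ᵏS`.
[cite: Matsumura1987, Theorem 8.7 / §8 (3) (mechanism)] -/
theorem mk_one_bijective_of_pow_smul_eq_zero [IsLocalRing R] [IsLocalRing S]
    [Module.FaithfullyFlat R S]
    (hmap : (maximalIdeal R).map (algebraMap R S) = maximalIdeal S)
    (hdense : ∀ (k : ℕ) (s : S), ∃ r : R, s - algebraMap R S r ∈ maximalIdeal S ^ k)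
    {A : Type u} [AddCommGroup A] [Module R A] {k : ℕ}
    (hA : ∀ x ∈ maximalIdeal R ^ k, ∀ a : A, x • a = 0) :
    Function.Bijective (TensorProduct.mk R S A 1) := by
  constructor
  · rw [← LinearMap.ker_eq_bot, LinearMap.ker_eq_bot']
    intro a ha
    exact (Module.FaithfullyFlat.one_tmul_eq_zero_iff (R := R) (M := A) (A := S) a).mp ha
  · intro u
    induction u using TensorProduct.induction_on with
    | zero => exact ⟨0, map_zero _⟩
    | tmul s a =>
      obtain ⟨r, hr⟩ := hdense k s
      have hn : (s - algebraMap R S r) ∈ (maximalIdeal R ^ k).map (algebraMap R S) := by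
        rw [Ideal.map_pow, hmap]
        exact hr
      refine ⟨r • a, ?_⟩
      have hs : s = algebraMap R S r + (s - algebraMap R S r) := by ring
      rw [TensorProduct.mk_apply, hs, TensorProduct.add_tmul, tmul_eq_zero_of_mem_map hA hn a,
        add_zero, Algebra.algebraMap_eq_smul_one, TensorProduct.smul_tmul]
    | add x y hx hy =>
      obtain ⟨a, rfl⟩ := hx
      obtain ⟨b, rfl⟩ := hy
      exact ⟨a + b, map_add _ _ _⟩

/-- An `S`-finite module killed by `𝔫ᵏ` is `R`-finite when `R` is dense in `S` (the same
generators work: `s • t = r • t` for `s ≡ r mod 𝔫ᵏ`). [folklore] -/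
theorem finite_restrictScalars_of_pow_smul_eq_zero [IsLocalRing S]
    (hdense : ∀ (k : ℕ) (s : S), ∃ r : R, s - algebraMap R S r ∈ maximalIdeal S ^ k)
    {T : Type u} [AddCommGroup T] [Module S T] [Module R T] [IsScalarTower R S T]
    [Module.Finite S T] {k : ℕ} (hT : ∀ x ∈ maximalIdeal S ^ k, ∀ t : T, x • t = 0) :
    Module.Finite R T := by
  obtain ⟨G, hG⟩ := Module.Finite.fg_top (R := S) (M := T)
  refine ⟨⟨G, ?_⟩⟩
  rw [eq_top_iff]
  rintro t -
  have ht : t ∈ Submodule.span S (G : Set T) := by rw [hG]; exact Submodule.mem_top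
  induction ht using Submodule.span_induction with
  | mem x hx => exact Submodule.subset_span hx
  | zero => exact Submodule.zero_mem _
  | add x y _ _ hx hy => exact Submodule.add_mem _ hx hy
  | smul s x _ hx =>
    obtain ⟨r, hr⟩ := hdense k s
    have hs : s • x = r • x := by
      have h0 := hT _ hr x
      rw [sub_smul, sub_eq_zero, algebraMap_smul] at h0
      exact h0
    rw [hs]
    exact Submodule.smul_mem _ r hx

/-! ## Passage to a quotient pair -/

/-- In a local ring, the image of the maximal ideal in a non-trivial quotient is the maximal ideal.
[folklore] -/
theorem map_mk_maximalIdeal [IsLocalRing R] (I : Ideal R) [IsLocalRing (R ⧸ I)] :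
    (maximalIdeal R).map (Ideal.Quotient.mk I) = maximalIdeal (R ⧸ I) := by
  rcases Ideal.map_eq_top_or_isMaximal_of_surjective (Ideal.Quotient.mk I)
    Ideal.Quotient.mk_surjective (IsLocalRing.maximalIdeal.isMaximal R) with h | h
  · exfalso
    have hI : I ≤ maximalIdeal R :=
      IsLocalRing.le_maximalIdeal ((Ideal.Quotient.nontrivial_iff).mp inferInstance)
    have := Ideal.comap_map_of_surjective (Ideal.Quotient.mk I) Ideal.Quotient.mk_surjective
      (maximalIdeal R)
    rw [h, Ideal.comap_top, ← RingHom.ker_eq_comap_bot, Ideal.mk_ker, sup_eq_left.mpr hI] at this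
    exact (IsLocalRing.maximalIdeal.isMaximal R).ne_top this.symm
  · exact IsLocalRing.eq_maximalIdeal h

/-- A non-trivial quotient of a local ring is local. [folklore] -/
theorem isLocalRing_quotient [IsLocalRing R] (I : Ideal R) [Nontrivial (R ⧸ I)] :
    IsLocalRing (R ⧸ I) :=
  IsLocalRing.of_surjective' (Ideal.Quotient.mk I) Ideal.Quotient.mk_surjective

/-- `𝔪S = 𝔫` is inherited by the quotient pair `(R/I, S/IS)`. [folklore] -/
theorem map_maximalIdeal_quotient [IsLocalRing R] [IsLocalRing S] (I : Ideal R)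
    [IsLocalRing (R ⧸ I)] [IsLocalRing (S ⧸ I.map (algebraMap R S))]
    (hmap : (maximalIdeal R).map (algebraMap R S) = maximalIdeal S) :
    (maximalIdeal (R ⧸ I)).map (algebraMap (R ⧸ I) (S ⧸ I.map (algebraMap R S))) =
      maximalIdeal (S ⧸ I.map (algebraMap R S)) := by
  rw [← map_mk_maximalIdeal I, Ideal.map_map, ← map_mk_maximalIdeal (I.map (algebraMap R S)),
    ← hmap, Ideal.map_map]
  congr 1

/-- Density `s ≡ r mod 𝔫ᵏ` is inherited by the quotient pair `(R/I, S/IS)`. [folklore] -/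
theorem dense_quotient [IsLocalRing S] (I : Ideal R) [IsLocalRing (S ⧸ I.map (algebraMap R S))]
    (hdense : ∀ (k : ℕ) (s : S), ∃ r : R, s - algebraMap R S r ∈ maximalIdeal S ^ k) :
    ∀ (k : ℕ) (s : S ⧸ I.map (algebraMap R S)), ∃ r : R ⧸ I,
      s - algebraMap (R ⧸ I) (S ⧸ I.map (algebraMap R S)) r ∈
        maximalIdeal (S ⧸ I.map (algebraMap R S)) ^ k := by
  intro k s
  obtain ⟨s, rfl⟩ := Ideal.Quotient.mk_surjective s
  obtain ⟨r, hr⟩ := hdense k s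
  refine ⟨Ideal.Quotient.mk I r, ?_⟩
  rw [← map_mk_maximalIdeal (I.map (algebraMap R S)), ← Ideal.map_pow]
  have h : algebraMap (R ⧸ I) (S ⧸ I.map (algebraMap R S)) (Ideal.Quotient.mk I r) =
      Ideal.Quotient.mk (I.map (algebraMap R S)) (algebraMap R S r) := rfl
  rw [h, ← map_sub]
  exact Ideal.mem_map_of_mem _ hr

/-! ## Tensor translation along a quotient pair -/

section Translation

variable (I : Ideal R) {N : Type u} [AddCommGroup N] [Module (R ⧸ I) N] [Module R N]
  [IsScalarTower R (R ⧸ I) N]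

/-- The comparison map `S ⊗_R N → (S/IS) ⊗_{R/I} N`, `s ⊗ n ↦ s̄ ⊗ n` (additive). [folklore] -/
theorem exists_toQuotientPair :
    ∃ Φ : S ⊗[R] N →+ (S ⧸ Ideal.map (algebraMap R S) I) ⊗[R ⧸ I] N,
      ∀ (s : S) (n : N), Φ (s ⊗ₜ[R] n) = (Ideal.Quotient.mk _ s) ⊗ₜ[R ⧸ I] n := by
  let F : S →+ (N →+ (S ⧸ Ideal.map (algebraMap R S) I) ⊗[R ⧸ I] N) :=
    { toFun := fun s =>
        (TensorProduct.mk (R ⧸ I) (S ⧸ Ideal.map (algebraMap R S) I) N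
          (Ideal.Quotient.mk _ s)).toAddMonoidHom
      map_zero' := by
        ext n
        change (Ideal.Quotient.mk _ (0 : S)) ⊗ₜ[R ⧸ I] n = 0
        rw [map_zero, TensorProduct.zero_tmul]
      map_add' := fun s t => by
        ext n
        change (Ideal.Quotient.mk _ (s + t)) ⊗ₜ[R ⧸ I] n =
          (Ideal.Quotient.mk _ s) ⊗ₜ[R ⧸ I] n + (Ideal.Quotient.mk _ t) ⊗ₜ[R ⧸ I] n
        rw [map_add, TensorProduct.add_tmul] }
  have hF : ∀ (s : S) (n : N), F s n = (Ideal.Quotient.mk _ s) ⊗ₜ[R ⧸ I] n := fun s n => rfl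
  refine ⟨TensorProduct.liftAddHom F (fun r s n => ?_), fun s n => ?_⟩
  · rw [hF, hF]
    have h1 : Ideal.Quotient.mk (Ideal.map (algebraMap R S) I) (r • s) =
        (Ideal.Quotient.mk I r) • Ideal.Quotient.mk (Ideal.map (algebraMap R S) I) s := by
      rw [Algebra.smul_def, map_mul, Algebra.smul_def]
      rfl
    have h2 : (Ideal.Quotient.mk I r) • n = r • n := by
      rw [← Ideal.Quotient.algebraMap_eq I]
      exact IsScalarTower.algebraMap_smul (R ⧸ I) r n
    rw [h1, TensorProduct.smul_tmul, h2]
  · rw [TensorProduct.liftAddHom_tmul, hF]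

/-- The comparison map `(S/IS) ⊗_{R/I} N → S ⊗_R N`, `s̄ ⊗ n ↦ s ⊗ n` (additive; well defined
because `IS` kills `S ⊗_R N`). [folklore] -/
theorem exists_ofQuotientPair :
    ∃ Ψ : (S ⧸ Ideal.map (algebraMap R S) I) ⊗[R ⧸ I] N →+ S ⊗[R] N,
      ∀ (s : S) (n : N), Ψ ((Ideal.Quotient.mk _ s) ⊗ₜ[R ⧸ I] n) = s ⊗ₜ[R] n := by
  -- for each `n`, `s̄ ↦ s ⊗ n : S/IS → S ⊗ N` (well defined because `IS` kills `S ⊗_R N`)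
  have hJ : ∀ n : N, Ideal.map (algebraMap R S) I ≤
      LinearMap.ker (LinearMap.toSpanSingleton S (S ⊗[R] N) ((1 : S) ⊗ₜ[R] n)) := by
    intro n
    rw [Ideal.map_le_iff_le_comap]
    intro a ha
    rw [Ideal.mem_comap, LinearMap.mem_ker, LinearMap.toSpanSingleton_apply,
      TensorProduct.smul_tmul', smul_eq_mul, mul_one, Algebra.algebraMap_eq_smul_one,
      TensorProduct.smul_tmul, ← IsScalarTower.algebraMap_smul (R ⧸ I) a n,
      Ideal.Quotient.algebraMap_eq, Ideal.Quotient.eq_zero_iff_mem.mpr ha, zero_smul,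
      TensorProduct.tmul_zero]
  let g : N → ((S ⧸ Ideal.map (algebraMap R S) I) →ₗ[S] S ⊗[R] N) := fun n =>
    Submodule.liftQ (Ideal.map (algebraMap R S) I)
      (LinearMap.toSpanSingleton S (S ⊗[R] N) ((1 : S) ⊗ₜ[R] n)) (hJ n)
  have hg : ∀ (s : S) (n : N), g n (Ideal.Quotient.mk _ s) = s ⊗ₜ[R] n := fun s n => by
    change Submodule.liftQ (Ideal.map (algebraMap R S) I)
      (LinearMap.toSpanSingleton S (S ⊗[R] N) ((1 : S) ⊗ₜ[R] n)) (hJ n) (Ideal.Quotient.mk _ s) = _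
    rw [← Ideal.Quotient.mk_eq_mk, Submodule.liftQ_apply, LinearMap.toSpanSingleton_apply,
      TensorProduct.smul_tmul', smul_eq_mul, mul_one]
  let F : (S ⧸ Ideal.map (algebraMap R S) I) →+ (N →+ S ⊗[R] N) :=
    { toFun := fun s =>
        { toFun := fun n => g n s
          map_zero' := by
            obtain ⟨s, rfl⟩ := Ideal.Quotient.mk_surjective s
            rw [hg, TensorProduct.tmul_zero]
          map_add' := fun n n' => by
            obtain ⟨s, rfl⟩ := Ideal.Quotient.mk_surjective s
            rw [hg, hg, hg, TensorProduct.tmul_add] }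
      map_zero' := by ext n; exact map_zero (g n)
      map_add' := fun s t => by ext n; exact map_add (g n) s t }
  have hF : ∀ (s : S) (n : N), F (Ideal.Quotient.mk _ s) n = s ⊗ₜ[R] n := fun s n => hg s n
  refine ⟨TensorProduct.liftAddHom F (fun r s n => ?_), fun s n => ?_⟩
  · obtain ⟨r, rfl⟩ := Ideal.Quotient.mk_surjective r
    obtain ⟨s, rfl⟩ := Ideal.Quotient.mk_surjective s
    have h1 : (Ideal.Quotient.mk I r) • (Ideal.Quotient.mk (Ideal.map (algebraMap R S) I) s) =
        Ideal.Quotient.mk _ (algebraMap R S r * s) := by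
      rw [Algebra.smul_def, map_mul]
      rfl
    have h2 : (Ideal.Quotient.mk I r) • n = r • n := by
      rw [← Ideal.Quotient.algebraMap_eq I]
      exact IsScalarTower.algebraMap_smul (R ⧸ I) r n
    rw [h1, hF, hF, h2, ← TensorProduct.smul_tmul, Algebra.smul_def]
  · rw [TensorProduct.liftAddHom_tmul, hF]

/-- **Tensor translation along a quotient pair.**  Let `I ⊆ R`, `N` an `R/I`-module (an `R`-module
through `R → R/I`) and `X` an `S`-module on which `IS` acts trivially, with its `S/IS`-structure. If
`X` is a retract of `(S/IS) ⊗_{R/I} N` over `S/IS`, then `X` is a retract of `S ⊗_R N` over `S`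
(compose with the comparison maps `s ⊗ n ↔ s̄ ⊗ n`, which are mutually inverse). [folklore] -/
theorem exists_retract_of_retract_quotientPair {X : Type u} [AddCommGroup X] [Module S X]
    [Module (S ⧸ Ideal.map (algebraMap R S) I) X]
    [IsScalarTower S (S ⧸ Ideal.map (algebraMap R S) I) X]
    (i : X →ₗ[S ⧸ Ideal.map (algebraMap R S) I] (S ⧸ Ideal.map (algebraMap R S) I) ⊗[R ⧸ I] N)
    (p : (S ⧸ Ideal.map (algebraMap R S) I) ⊗[R ⧸ I] N →ₗ[S ⧸ Ideal.map (algebraMap R S) I] X)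
    (h : p ∘ₗ i = LinearMap.id) :
    ∃ (i' : X →ₗ[S] S ⊗[R] N) (p' : S ⊗[R] N →ₗ[S] X), p' ∘ₗ i' = LinearMap.id := by
  obtain ⟨Φ, hΦ⟩ := exists_toQuotientPair (S := S) I (N := N)
  obtain ⟨Ψ, hΨ⟩ := exists_ofQuotientPair (S := S) I (N := N)
  -- `Φ ∘ Ψ = id`
  have hΦΨ : ∀ v, Φ (Ψ v) = v := by
    intro v
    induction v using TensorProduct.induction_on with
    | zero => rw [map_zero, map_zero]
    | tmul s n =>
      obtain ⟨s, rfl⟩ := Ideal.Quotient.mk_surjective s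
      rw [hΨ, hΦ]
    | add x y hx hy => rw [map_add, map_add, hx, hy]
  -- semilinearity
  have hΨsmul : ∀ (s : S) (v : (S ⧸ Ideal.map (algebraMap R S) I) ⊗[R ⧸ I] N),
      Ψ ((Ideal.Quotient.mk (Ideal.map (algebraMap R S) I) s) • v) = s • Ψ v := by
    intro s v
    induction v using TensorProduct.induction_on with
    | zero => rw [smul_zero, map_zero, smul_zero]
    | tmul t n =>
      obtain ⟨t, rfl⟩ := Ideal.Quotient.mk_surjective t
      rw [TensorProduct.smul_tmul', smul_eq_mul,
        ← map_mul (Ideal.Quotient.mk (Ideal.map (algebraMap R S) I)), hΨ, hΨ,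
        TensorProduct.smul_tmul', smul_eq_mul]
    | add x y hx hy => rw [smul_add, map_add, hx, hy, map_add, smul_add]
  have hΦsmul : ∀ (s : S) (u : S ⊗[R] N),
      Φ (s • u) = (Ideal.Quotient.mk (Ideal.map (algebraMap R S) I) s) • Φ u := by
    intro s u
    induction u using TensorProduct.induction_on with
    | zero => rw [smul_zero, map_zero, smul_zero]
    | tmul t n =>
      rw [TensorProduct.smul_tmul', smul_eq_mul, hΦ, hΦ, TensorProduct.smul_tmul', smul_eq_mul,
        map_mul]
    | add x y hx hy => rw [smul_add, map_add, hx, hy, map_add, smul_add]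
  have hpi : ∀ x, p (i x) = x := fun x => LinearMap.congr_fun h x
  let i' : X →ₗ[S] S ⊗[R] N :=
    { toFun := fun x => Ψ (i x)
      map_add' := fun x y => by rw [map_add, map_add]
      map_smul' := fun s x => by
        rw [RingHom.id_apply, ← hΨsmul, ← map_smul,
          ← IsScalarTower.algebraMap_smul (S ⧸ Ideal.map (algebraMap R S) I) s x,
          Ideal.Quotient.algebraMap_eq (Ideal.map (algebraMap R S) I)] }
  let p' : S ⊗[R] N →ₗ[S] X :=
    { toFun := fun u => p (Φ u)
      map_add' := fun u v => by rw [map_add, map_add]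
      map_smul' := fun s u => by
        rw [RingHom.id_apply, hΦsmul, map_smul,
          ← Ideal.Quotient.algebraMap_eq (Ideal.map (algebraMap R S) I), IsScalarTower.algebraMap_smul] }
  refine ⟨i', p', LinearMap.ext fun x => ?_⟩
  change p (Φ (Ψ (i x))) = x
  rw [hΦΨ, hpi]

end Translation

end Summit.ResolutionOfSingularities.ResolutionOfSingularities.Theorems.HomologicalConductor.CompletionAscentQuotientPair

end
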